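import Mathlib
import Summits.ValiantsHypothesis.ValiantsHypothesis.Theorems.DivisionGapPerMultiplesHardRichFacesDeep
import Literature.Computability.AlgebraicComplexity.ArithCircuitProofs
import Literature.Computability.AlgebraicComplexity.PermanentIrreducible

/-!
# `DivisionGap.PerMultiplesHard` (stmt-ValiantsHypothesis-5068), line `uncharged-face-walk`:
stub `densePerHardReg` — `DensePerHard` for regular hosts, modulo van der Waerden

For `n ≥ 9`, `k ≥ 1` and a `k`-regular host `G ⊆ [n]²` (every row and every column of `G` has
exactly `k` cells), with `per_G := Σ_{σ ⊆ G} x^{μ_σ}`, `L := L⁺(per_G)` (the tree's monotone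
fan-in-two `complexity` over `ℝ≥0`) and `k₀ := ⌊n/3⌋ + 1`,

  `k^n · 3^n · 3^{k₀} ≤ L² · n^n · (n+1) (k₀+1) · 2^{n-⌊n/3⌋} · 2^{k₀-⌊k₀/3⌋}`,

PROVIDED the van der Waerden permanent bound (Egorychev 1981 / Falikman 1981: `per A ≥ m!/m^m`
for every doubly stochastic real `m × m` matrix `A`), taken here as an EXPLICIT hypothesis in the
cross-multiplied form `m! ≤ m^m · per A` (the tree does not hold it yet).

Proof.
1. The permanent of the `0/1` matrix `B` of `G` is `#PM(G)`, the number of permutations inside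
   `G` (`Fintype.prod_boole`, `Finset.sum_boole`).
2. `A := (1/k) • B` is doubly stochastic by `k`-regularity, so the hypothesis and
   `Matrix.permanent_smul` give `n! ≤ n^n · ((1/k)^n · #PM(G))`, i.e. `k^n · n! ≤ n^n · #PM(G)`
   (over `ℝ`, then cast to `ℕ`).
3. Multiply the deep richness engine `RichFacesDeep.richFacesDeep`
   (`#PM(G) · 3^n · 3^{k₀} ≤ L² · n! · Y`) by `n^n`, use step 2, and cancel `n! > 0`.
-/

-- `Summit.ValiantsHypothesis.ValiantsHypothesis.…` is the tree's mandated layout (Sub = Summit).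
set_option linter.dupNamespace false

open MvPolynomial Literature.Computability.AlgebraicComplexity
open scoped NNReal BigOperators

namespace Summit.ValiantsHypothesis.ValiantsHypothesis.Theorems.DivisionGap.PerMultiplesHard.DensePerHardReg

/-- **The permanent of the `0/1` matrix of `G` counts the permutations inside `G`.**
With `B r c = [(r, c) ∈ G]`, `per B = Σ_σ Π_i [(σ i, i) ∈ G] = #{σ | ∀ i, (σ i, i) ∈ G}`.
[folklore] -/
theorem permanent_indicator_eq_card {n : ℕ} (G : Finset (Fin n × Fin n)) :
    (Matrix.of fun r c : Fin n => if (r, c) ∈ G then (1 : ℝ) else 0).permanent =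
      (((Finset.univ : Finset (Equiv.Perm (Fin n))).filter
        (fun σ => ∀ i, (σ i, i) ∈ G)).card : ℝ) := by
  unfold Matrix.permanent
  rw [Finset.natCast_card_filter (fun σ : Equiv.Perm (Fin n) => ∀ i, (σ i, i) ∈ G)]
  refine Finset.sum_congr rfl fun σ _ => ?_
  simp only [Matrix.of_apply]
  -- adapted from Literature/Computability/AlgebraicComplexity/PermanentBitsPPoly.lean
  -- (`permanent_of_bool`)
  split_ifs with h
  · exact Finset.prod_eq_one fun i _ => by rw [if_pos (h i)]
  · obtain ⟨i, hi⟩ := not_forall.1 h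
    exact Finset.prod_eq_zero (Finset.mem_univ i) (by rw [if_neg hi])

/-- **Row sums of the `0/1` matrix of `G`.**  `Σ_c [(r, c) ∈ G] = #{c | (r, c) ∈ G}` (in `ℝ`).
[folklore] -/
theorem sum_indicator_row {n : ℕ} (G : Finset (Fin n × Fin n)) (r : Fin n) :
    ∑ c : Fin n, (if (r, c) ∈ G then (1 : ℝ) else 0) =
      ((Finset.univ.filter fun c : Fin n => (r, c) ∈ G).card : ℝ) :=
  Finset.sum_boole _ _

/-- **Column sums of the `0/1` matrix of `G`.**  `Σ_r [(r, c) ∈ G] = #{r | (r, c) ∈ G}` (in `ℝ`).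
[folklore] -/
theorem sum_indicator_col {n : ℕ} (G : Finset (Fin n × Fin n)) (c : Fin n) :
    ∑ r : Fin n, (if (r, c) ∈ G then (1 : ℝ) else 0) =
      ((Finset.univ.filter fun r : Fin n => (r, c) ∈ G).card : ℝ) :=
  Finset.sum_boole _ _

/-- **The counting consequence of van der Waerden for regular hosts.**  If every doubly
stochastic real matrix `A` satisfies `m! ≤ m^m · per A`, then for a `k`-regular `G ⊆ [n]²` with
`k ≥ 1` the number of permutations inside `G` is at least `k^n · n! / n^n`:
`k^n · n! ≤ n^n · #PM(G)`.  Apply the hypothesis to the doubly stochastic `(1/k) • B`, `B` the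
`0/1` matrix of `G`, and use `per ((1/k) • B) = (1/k)^n · per B = (1/k)^n · #PM(G)`
(`Matrix.permanent_smul`, `permanent_indicator_eq_card`). [folklore] -/
theorem pow_mul_factorial_le_of_vdW
    (hvdW : ∀ (m : ℕ) (A : Matrix (Fin m) (Fin m) ℝ), (∀ i j, 0 ≤ A i j) →
      (∀ i, ∑ j, A i j = 1) → (∀ j, ∑ i, A i j = 1) →
      (m.factorial : ℝ) ≤ (m : ℝ) ^ m * A.permanent)
    {n k : ℕ} (G : Finset (Fin n × Fin n)) (hk : 1 ≤ k)
    (hrow : ∀ i : Fin n, (Finset.univ.filter fun j : Fin n => (i, j) ∈ G).card = k)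
    (hcol : ∀ j : Fin n, (Finset.univ.filter fun i : Fin n => (i, j) ∈ G).card = k) :
    k ^ n * n.factorial ≤
      n ^ n * ((Finset.univ : Finset (Equiv.Perm (Fin n))).filter
        (fun σ => ∀ i, (σ i, i) ∈ G)).card := by
  set B : Matrix (Fin n) (Fin n) ℝ :=
    Matrix.of fun r c : Fin n => if (r, c) ∈ G then (1 : ℝ) else 0 with hB
  set A : Matrix (Fin n) (Fin n) ℝ := (1 / (k : ℝ)) • B with hA
  have hkpos : (0 : ℝ) < k := by exact_mod_cast hk
  have hAentry : ∀ i j, A i j = 1 / (k : ℝ) * (if (i, j) ∈ G then (1 : ℝ) else 0) := by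
    intro i j
    simp only [hA, hB, Matrix.smul_apply, Matrix.of_apply, smul_eq_mul]
  have hA0 : ∀ i j, 0 ≤ A i j := by
    intro i j
    rw [hAentry]
    exact mul_nonneg (by positivity) (by split_ifs <;> norm_num)
  have hArow : ∀ i, ∑ j, A i j = 1 := by
    intro i
    simp_rw [hAentry]
    rw [← Finset.mul_sum, sum_indicator_row, hrow i]
    field_simp
  have hAcol : ∀ j, ∑ i, A i j = 1 := by
    intro j
    simp_rw [hAentry]
    rw [← Finset.mul_sum, sum_indicator_col, hcol j]
    field_simp
  have h := hvdW n A hA0 hArow hAcol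
  rw [hA, Matrix.permanent_smul, Fintype.card_fin, hB, permanent_indicator_eq_card] at h
  -- `h : n! ≤ n^n * ((1/k)^n * #PM(G))`; multiply by `k^n`
  have hR : ((k ^ n * n.factorial : ℕ) : ℝ) ≤
      ((n ^ n * ((Finset.univ : Finset (Equiv.Perm (Fin n))).filter
        (fun σ => ∀ i, (σ i, i) ∈ G)).card : ℕ) : ℝ) := by
    push_cast
    calc (k : ℝ) ^ n * (n.factorial : ℝ)
        ≤ (k : ℝ) ^ n * ((n : ℝ) ^ n * ((1 / (k : ℝ)) ^ n *
            (((Finset.univ : Finset (Equiv.Perm (Fin n))).filter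
              (fun σ => ∀ i, (σ i, i) ∈ G)).card : ℝ))) :=
          mul_le_mul_of_nonneg_left h (pow_nonneg hkpos.le n)
      _ = (n : ℝ) ^ n * (((Finset.univ : Finset (Equiv.Perm (Fin n))).filter
              (fun σ => ∀ i, (σ i, i) ∈ G)).card : ℝ) * ((k : ℝ) * (1 / (k : ℝ))) ^ n := by
          ring
      _ = (n : ℝ) ^ n * (((Finset.univ : Finset (Equiv.Perm (Fin n))).filter
              (fun σ => ∀ i, (σ i, i) ∈ G)).card : ℝ) := by
          rw [mul_one_div_cancel hkpos.ne', one_pow, mul_one]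
  exact_mod_cast hR

/-- **densePerHardReg — `DensePerHard` for regular hosts, modulo van der Waerden.**  Assuming
the van der Waerden permanent bound `m! ≤ m^m · per A` for doubly stochastic real `A`
(Egorychev–Falikman 1981; an explicit hypothesis here), for `n ≥ 9`, `k ≥ 1` and every
`k`-regular `G ⊆ [n]²` (all row and column degrees equal to `k`), with
`per_G = Σ_{σ ⊆ G} x^{μ_σ}`, `L = L⁺(per_G)` and `k₀ = ⌊n/3⌋ + 1`:
`k^n · 3^n · 3^{k₀} ≤ L² · n^n · (n+1) (k₀+1) · 2^{n-⌊n/3⌋} · 2^{k₀-⌊k₀/3⌋}`.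
The deep richness engine `RichFacesDeep.richFacesDeep` (`#PM(G) · 3^n · 3^{k₀} ≤ L² · n! · Y`)
times `n^n`, the count `k^n · n! ≤ n^n · #PM(G)` (`pow_mul_factorial_le_of_vdW`), and
cancellation of `n! > 0`. [cite: JerrumSnir1982, §3–§4.3] -/
theorem densePerHardReg :
    (∀ (m : ℕ) (A : Matrix (Fin m) (Fin m) ℝ), (∀ i j, 0 ≤ A i j) → (∀ i, ∑ j, A i j = 1) →
      (∀ j, ∑ i, A i j = 1) → (m.factorial : ℝ) ≤ (m : ℝ) ^ m * A.permanent) →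
    ∀ n ≥ 9, ∀ (k : ℕ) (G : Finset (Fin n × Fin n)), 1 ≤ k →
      (∀ i : Fin n, (Finset.univ.filter fun j : Fin n => (i, j) ∈ G).card = k) →
      (∀ j : Fin n, (Finset.univ.filter fun i : Fin n => (i, j) ∈ G).card = k) →
      k ^ n * (3 ^ n * 3 ^ (n / 3 + 1)) ≤
        complexity (∑ σ ∈ (Finset.univ : Finset (Equiv.Perm (Fin n))).filter
            (fun σ => ∀ i, (σ i, i) ∈ G), monomial (permMonomial σ) (1 : ℝ≥0)) ^ 2 *
          (n ^ n * ((n + 1) * (n / 3 + 2) *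
            (2 ^ (n - n / 3) * 2 ^ ((n / 3 + 1) - (n / 3 + 1) / 3)))) := by
  intro hvdW n hn k G hk hrow hcol
  have hrich := RichFacesDeep.richFacesDeep n hn G
  have hcount := pow_mul_factorial_le_of_vdW hvdW G hk hrow hcol
  set P := ((Finset.univ : Finset (Equiv.Perm (Fin n))).filter (fun σ => ∀ i, (σ i, i) ∈ G)).card
    with hP
  set L := complexity (∑ σ ∈ (Finset.univ : Finset (Equiv.Perm (Fin n))).filter
    (fun σ => ∀ i, (σ i, i) ∈ G), monomial (permMonomial σ) (1 : ℝ≥0)) with hL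
  set X := 3 ^ n * 3 ^ (n / 3 + 1) with hX
  set Y := (n + 1) * (n / 3 + 2) * (2 ^ (n - n / 3) * 2 ^ ((n / 3 + 1) - (n / 3 + 1) / 3))
    with hY
  -- `hrich : P * X ≤ L ^ 2 * (n! * Y)`, `hcount : k ^ n * n! ≤ n ^ n * P`
  refine Nat.le_of_mul_le_mul_left (c := n.factorial) ?_ (Nat.factorial_pos n)
  calc n.factorial * (k ^ n * X) = k ^ n * n.factorial * X := by ring
    _ ≤ n ^ n * P * X := Nat.mul_le_mul_right _ hcount
    _ = n ^ n * (P * X) := by ring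
    _ ≤ n ^ n * (L ^ 2 * (n.factorial * Y)) := Nat.mul_le_mul_left _ hrich
    _ = n.factorial * (L ^ 2 * (n ^ n * Y)) := by ring

end Summit.ValiantsHypothesis.ValiantsHypothesis.Theorems.DivisionGap.PerMultiplesHard.DensePerHardReg
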